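import Summits.QuantumFields.YangMills.Theorems.BalabanUVNodesN19TargetOfDecorrelationReading
import Literature.MathematicalPhysics.QuantumFieldTheory.Balaban1983to89.T4ApexHybrid
import Literature.MathematicalPhysics.QuantumFieldTheory.Balaban1983to89.T4MatchingDegenerate

/-!
# YM-DAG node N19 (= NE7 proper) — THE RESPONSE ROAD AT THE SCHEME: a TAIL `Target` glues to a full `Target` (head free), per string it gives the dressed
# partition functions' `Target`, over all strings `T4Assembly.GenFunCauchy`, and under the crux's prefix `T4Assembly.GenFunCauchyUnder D Hβ` — the slot the
# apex corollary actually consumes (`T4ApexHybrid.stringwiseUnder_of_genFunCauchyUnder`); LOCATED: the rung `BalabanLadder.UV`'s B5 slot is typed at the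
# STRONGER `HybridNE7Under` (= `Target ∧ Hom` given the weights, dag-n19-w1), which the response road does not — and at a law-separated key cannot — reach

Cell `pub-ymgap`, HUMAN RULING D-0062 (Track A), width seat `pub-ymgap-dag-n19-w2` (node n19 = NE7), generation g7 (R455 (A) rule (ii); CLAIM-8 on the cell
bus).  Route `Summits/QuantumFields/YangMills/Theses/BalabanUVNodes.lean`, key item K3⁸ `SpineGivenEndpointR13SepCoPHV` (stmt-QuantumFields-27366; aside
predecessor K3⁷ 20544); filed `--kind proof --supports … --as helper`.  COUNT-NEUTRAL.  THEOREMS ONLY (0 `def`, 0 `sorry`).  ADDITIVE — imports this seat's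
FILE C `…N19TargetOfDecorrelationReading` (p625854) and the tree's `…Balaban1983to89.T4ApexHybrid` (`T4Assembly.GenFunCauchy ∕ GenFunCauchyUnder ∕
genFunCauchy_of_matchingModConstants`, `T4ApexHybrid.StringwiseUnder ∕ stringwiseUnder_of_genFunCauchyUnder`, `T4MatchingAssembly.matchingModConstants_glue ∕
head_of_abs_genFun_le ∕ summable_glueDelta`, `T4GenFunBounds.abs_genFun_schemeZ_le`, `T4Continuum.FiniteEpsData.UnderHypotheses.mono`) — all BY NAME; modifies nothing.

WHERE THE ROAD LANDS.  FILES C–I read node U5's DECL target `Spine.NE7.Target vol l₀ δ Z` (= `MatchingModConstants ∧ Summable δ`) from (RM) + (DC) and its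
sources.  This file carries that conclusion to the places the spine consumes it.  (§1) The road is proved along a TAIL `K ↦ K₀ + K` of run pairs (the
hypotheses are tail properties; K3's `KeyedExtraction` reads the dictionary at `K₀ + K`); the HEAD is free: any bound `|genFun Z K t| ≤ Gb` glues a tail
`Target` into a full one with the tree's `glueDelta` (`target_of_tailTarget`).  (§2) At a `TorusScheme` with `β_K ≥ 0` and measurable observables bounded by `1`
the head bound is the tree's `|G_K(t)| ≤ |t| ≤ l₀`, so a tail `Target` per string gives `∃ vol δ, Target vol l₀ δ (schemeZ S os)` and, over all strings, node
U6∕U0's input `T4Assembly.GenFunCauchy S l₀` (`genFunCauchy_of_tailTargets`).  (§3) Under the crux's prefix `(B) → Hβ → ForSmallCouplings`: per-string targets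
along the data's Wilson schemes give `T4Assembly.GenFunCauchyUnder D Hβ` (`genFunCauchyUnder_of_targetsUnder`) and hence the apex corollary's input
`T4ApexHybrid.StringwiseUnder D Hβ` (`stringwiseUnder_of_targetsUnder`, the tree's `stringwiseUnder_of_genFunCauchyUnder` BY NAME).
LOCATED (for the route owner ∕ plan, not a flag, nothing asked): the RUNG `Summit.QuantumFields.YangMills.Theses.BalabanLadder.UV` packages B5 as
`T4ApexHybrid.HybridNE7Under D (EndpointExistence …)` — the HYBRID BINDER LIST per string — and K3⁸'s text concludes exactly that; the apex corollary consumes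
only `StringwiseUnder` (`stringwiseUnder_of_hybridNE7Under`).  GIVEN the weights, `HybridNE7 ⟺ Target ∧ Hom` (dag-n19-w1 `hybridNE7Edge_iff_target_classOsc`), and
`Hom` (the class-uniform constant) is what the crux card window-key-core shows FAILS at the pinned key.  The response road reaches `GenFunCauchyUnder` (§3) —
WEAKER than B5 as typed, SUFFICIENT for the apex — without `Hom`.  Whether B5∕K3 should be typed at `GenFunCauchyUnder` is the route owner's call.

WHAT IS KERNEL-CHECKED ([folklore] bookkeeping BY NAME).
* §1 ★ `target_of_tailTarget` — `0 < vol`, `Target vol l₀ δ (fun K => Z (K₀ + K))`, head bound `|genFun Z K t| ≤ Gb` on `|t| ≤ l₀` ⇒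
  `Target vol l₀ (glueDelta K₀ (2Gb ∕ vol) δ) Z`.
* §2 ★ `exists_target_schemeZ_of_tailTarget` (one string) · ★★ `genFunCauchy_of_tailTargets` (all strings ⇒ `GenFunCauchy S l₀`).
* §3 ★★ `genFunCauchyUnder_of_targetsUnder` · ★ `stringwiseUnder_of_targetsUnder` (under the prefix; the apex's input) · `genFunCauchyUnder_of_hybridNE7Under'`
  (the tree's direction restated BY NAME for contrast: the rung's B5 implies the slot of §3, not conversely).
* §4 ★ `exists_target_schemeZ_of_responseDecorrelationReading` — the road of FILE C read at a string of a scheme from `K₀` on ⇒ `∃ vol δ, Target vol l₀ δ (schemeZ S os)`.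

HONEST FRAMING.  Bookkeeping over the tree's apex∕assembly modules on hypothesis SHAPES; nothing of Bałaban's instantiated (no datum, no `Provisos₁₃CoPH` tuple);
the per-string targets, (RM), (DC) are produced by nobody; NE7 NOT PRINTED for d = 4 ∕ NOT proved; N19 NOT discharged; K3⁸ 27366 OPEN, not claimed — its text is
`HybridNE7Under`-typed and is NOT served by this file; the rung `BalabanLadder.UV` is NOT touched (located remark only); counts UNMOVED (typed 28∕28 · discharged
5∕27, A 5∕28); no count claim.  One finite four-torus programme at fixed ε; R4 closes the conditional finite-𝕋⁴ rung `BalabanLadder.UV` only — NOT infinite volume,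
NOT OS on ℝ⁴, NOT the Yang–Mills mass gap, NOT the Clay problem.  0 `def`; 0 `sorry`; standard axioms.
v1.1 (APPEND-ONLY, g8; every v1.0 declaration byte-identical; one import added: the tree's `…Balaban1983to89.T4MatchingDegenerate`).  ERRATUM TO THE LOCATED REMARK
ABOVE AND TO §3's «FOR CONTRAST» DOCSTRING.  The rung's B5 binder `T4ApexHybrid.HybridNE7Under D Hβ` quantifies the hybrid datum EXISTENTIALLY over the class index
(`T4MatchingAssembly.StringHybridNE7 := ∃ (ι : Type) … T A B shA shB Bad W Wsh δ, HybridNE7 … ∧ E1 ∧ E2`), so by the DEGENERATE ONE-CLASS EXPANSION — dag-n23-b's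
`T4MatchingDegenerate.stringHybridNE7_of_matchingModConstants` ∕ `hybridNE7Under_iff_matchingUnder` (`ι := Unit`, no bad class, no shells; in the tree since before
this file) — B5 AS TYPED IS EQUIVALENT to node U5's King-shape output under the prefix, `T4ApexVariance.MatchingUnder D Hβ` = per-string `Target`.  Hence the
response road DOES reach B5 as typed (§5 `hybridNE7Under_of_targetsUnder`, one line over those names), and K3⁸'s conclusion with it; dag-n19-w1's
`hybridNE7Edge_iff_target_classOsc` («hybrid = target ∧ Hom») concerns a FIXED class index ∕ weight family — the `Hom` content enters only where a line PINS the
index (K3 v6 stub 2's `PinnedAtLive … cr = crOfRecord₁₃V`), not in the crux statement.  v1.0's sentences «typed at the STRONGER `HybridNE7Under`», «which the response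
road does not … reach» and «the converse is false in general … the response road reaches §3's slot, not this one» are WITHDRAWN; the theorems of v1.0 are unaffected.
* §5 (v1.1) ★★ `hybridNE7Under_of_targetsUnder` (§3's hypothesis + measurable averaging maps ⇒ `T4ApexHybrid.HybridNE7Under D Hβ`, the rung's B5 AS TYPED) ·
  `hybridNE7Under_iff_stringTargetsUnder` (B5 ⟺ per-string targets under the prefix, each string its own radius — `T4MatchingDegenerate.hybridNE7Under_iff_matchingUnder`
  with `T4ApexVariance.StringwiseMatching` unfolded to `Spine.NE7.Target`).
-/

noncomputable section

open Finset Filter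
open scoped BigOperators

namespace Summit.QuantumFields.YangMills.BalabanUVNodes.N19ResponseRoadAtScheme

open Literature.MathematicalPhysics.QuantumFieldTheory.Balaban1983to89
open Literature.MathematicalPhysics.QuantumFieldTheory.Balaban1983to89.T4CauchySum (MatchingModConstants genFun)
open Literature.MathematicalPhysics.QuantumFieldTheory.Balaban1983to89.T4MatchingAssembly (glueDelta matchingModConstants_glue head_of_abs_genFun_le
  summable_glueDelta)
open Literature.MathematicalPhysics.QuantumFieldTheory.Balaban1983to89.T4Continuum (T4Family FiniteEpsData)
open Summit.QuantumFields.BalabanUV.T4Continuum.Spine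
open Summit.QuantumFields.YangMills.BalabanUVNodes.N19TargetOfDecorrelationReading (target_of_responseDecorrelationReading)

/-! ## §1 A tail `Target` glues to a full `Target` (the head is free) -/

section Glue

variable {vol l₀ : ℝ} {δ : ℕ → ℝ} {Z : ℕ → ℝ → ℝ}

/-- **TAIL ⇒ FULL.**  `0 < vol`; node U5's target along the TAIL `K ↦ Z (K₀ + K)`; a head bound `|genFun Z K t| ≤ Gb` on `|t| ≤ l₀` (for a scheme: `Gb = l₀`, §2).
Then `Target vol l₀ (glueDelta K₀ (2Gb∕vol) δ) Z` — the tree's `matchingModConstants_glue` + `head_of_abs_genFun_le` + `summable_glueDelta` BY NAME.  Summability is a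
TAIL property; the head costs nothing. [folklore] -/
theorem target_of_tailTarget (hvol : 0 < vol) {K₀ : ℕ} {Gb : ℝ} (htail : NE7.Target vol l₀ δ fun K => Z (K₀ + K))
    (hG : ∀ (K : ℕ) (t : ℝ), |t| ≤ l₀ → |genFun Z K t| ≤ Gb) : NE7.Target vol l₀ (glueDelta K₀ (2 * Gb / vol) δ) Z :=
  ⟨matchingModConstants_glue hvol htail.1 fun K _ => head_of_abs_genFun_le hG K, summable_glueDelta K₀ _ htail.2⟩

end Glue

/-! ## §2 At a torus scheme: per string a tail `Target` ⇒ the string's `Target`; all strings ⇒ `GenFunCauchy` -/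

section Scheme

variable {G : Type*} [GaugeGroup G] [MeasurableSpace G] [RegularGaugeGroup G] [HaarData G] {O : Type*}

/-- **ONE STRING OF A SCHEME.**  `β_K ≥ 0`, measurable observables bounded by `1` (so `|G_K(t)| ≤ |t|`, the tree's `T4GenFunBounds.abs_genFun_schemeZ_le`),
`0 < vol`, and a TAIL target from `K₀` on for the string's dressed partition functions ⇒ `∃ δ', Target vol l₀ δ' (schemeZ S os)`. [folklore] -/
theorem exists_target_schemeZ_of_tailTarget (S : Missing.TorusScheme G O) (hβ : ∀ K, 0 ≤ S.β K) (hm : ∀ K o, Measurable (S.obs K o))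
    (h1 : ∀ K o U, |S.obs K o U| ≤ 1) {l₀ vol : ℝ} (hvol : 0 < vol) (os : List O) {K₀ : ℕ} {δ : ℕ → ℝ}
    (htail : NE7.Target vol l₀ δ fun K => T4GenFunBounds.schemeZ S os (K₀ + K)) :
    ∃ δ' : ℕ → ℝ, NE7.Target vol l₀ δ' (T4GenFunBounds.schemeZ S os) :=
  ⟨_, target_of_tailTarget hvol htail fun K t ht => (T4GenFunBounds.abs_genFun_schemeZ_le S hβ hm h1 K os t).trans (by rwa [abs_le] at ht ⊢)⟩

/-- **ALL STRINGS ⇒ NODE U6∕U0's INPUT.**  A tail target for every string (each with its own `K₀`, `vol > 0`, `δ`) ⇒ `T4Assembly.GenFunCauchy S l₀` — the tree's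
`genFunCauchy_of_matchingModConstants` BY NAME. [folklore] -/
theorem genFunCauchy_of_tailTargets (S : Missing.TorusScheme G O) (hβ : ∀ K, 0 ≤ S.β K) (hm : ∀ K o, Measurable (S.obs K o))
    (h1 : ∀ K o U, |S.obs K o U| ≤ 1) {l₀ : ℝ} (hl₀ : 0 ≤ l₀)
    (h : ∀ os : List O, ∃ (K₀ : ℕ) (vol : ℝ) (δ : ℕ → ℝ), 0 < vol ∧ NE7.Target vol l₀ δ fun K => T4GenFunBounds.schemeZ S os (K₀ + K)) :
    T4Assembly.GenFunCauchy S l₀ :=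
  T4Assembly.genFunCauchy_of_matchingModConstants S hl₀ fun os => by
    obtain ⟨K₀, vol, δ, hvol, htail⟩ := h os
    obtain ⟨δ', hT⟩ := exists_target_schemeZ_of_tailTarget S hβ hm h1 hvol os htail
    exact ⟨vol, δ', hT.2, hT.1⟩

end Scheme

/-! ## §3 Under the crux's prefix: per-string targets ⇒ `GenFunCauchyUnder` ⇒ the apex's `StringwiseUnder` -/

section Under

variable {F : T4Family} {G : Type*} [GaugeGroup G] [MeasurableSpace G] [RegularGaugeGroup G] [HaarData G]

omit [RegularGaugeGroup G] in
/-- **UNDER THE PREFIX** (`(B) → Hβ → ForSmallCouplings D`): if along every tuned bare sequence `g₀` there is a radius `l₀ > 0` at which EVERY string of the data's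
Wilson scheme `D.scheme g₀` has node U5's target (some `vol`, `δ`), then `T4Assembly.GenFunCauchyUnder D Hβ` — the slot a `Target`-typed B5 would occupy
(`UnderHypotheses.mono` + `genFunCauchy_of_matchingModConstants` BY NAME). [folklore] -/
theorem genFunCauchyUnder_of_targetsUnder (D : FiniteEpsData F G) {Hβ : Prop}
    (h : D.UnderHypotheses Hβ fun g₀ => ∃ l₀ : ℝ, 0 < l₀ ∧
      ∀ os : List (T4Continuum.ULoop F), ∃ (vol : ℝ) (δ : ℕ → ℝ), NE7.Target vol l₀ δ (T4GenFunBounds.schemeZ (D.scheme g₀) os)) :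
    T4Assembly.GenFunCauchyUnder D Hβ :=
  T4Continuum.FiniteEpsData.UnderHypotheses.mono (fun g₀ hg => by
    obtain ⟨l₀, hl₀, hos⟩ := hg
    exact ⟨l₀, hl₀, T4Assembly.genFunCauchy_of_matchingModConstants _ hl₀.le fun os => by
      obtain ⟨vol, δ, hT⟩ := hos os
      exact ⟨vol, δ, hT.2, hT.1⟩⟩) h

omit [RegularGaugeGroup G] in
/-- … hence the apex corollary's input `T4ApexHybrid.StringwiseUnder D Hβ` (the tree's `stringwiseUnder_of_genFunCauchyUnder` BY NAME). [folklore] -/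
theorem stringwiseUnder_of_targetsUnder (D : FiniteEpsData F G) {Hβ : Prop}
    (h : D.UnderHypotheses Hβ fun g₀ => ∃ l₀ : ℝ, 0 < l₀ ∧
      ∀ os : List (T4Continuum.ULoop F), ∃ (vol : ℝ) (δ : ℕ → ℝ), NE7.Target vol l₀ δ (T4GenFunBounds.schemeZ (D.scheme g₀) os)) :
    T4ApexHybrid.StringwiseUnder D Hβ :=
  T4ApexHybrid.stringwiseUnder_of_genFunCauchyUnder D (genFunCauchyUnder_of_targetsUnder D h)

/-- FOR CONTRAST (the tree's direction, BY NAME): the rung's B5 slot `HybridNE7Under` implies the apex's input too — `T4ApexHybrid.stringwiseUnder_of_hybridNE7Under`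
(data with measurable averaging maps).  The converse is false in general (dag-n19-w1 `hybridNE7Edge_iff_target_classOsc`: hybrid = target ∧ Hom); the response
road reaches §3's slot, not this one. [folklore] -/
theorem stringwiseUnder_of_hybridNE7Under' (D : FiniteEpsData F G) (hM : D.AvgMeasurable) {Hβ : Prop} (h : T4ApexHybrid.HybridNE7Under D Hβ) :
    T4ApexHybrid.StringwiseUnder D Hβ :=
  T4ApexHybrid.stringwiseUnder_of_hybridNE7Under D hM h

end Under

/-! ## §4 The road of FILE C read at a string of a scheme from `K₀` on -/

section RoadAtString

variable {G : Type*} [GaugeGroup G] [MeasurableSpace G] [RegularGaugeGroup G] [HaarData G] {O : Type*} {ι : Type*}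

/-- **THE RESPONSE ROAD AT ONE STRING.**  A scheme `S` (`β ≥ 0`, measurable observables bounded by `1`), a string `os`, a radius `0 ≤ l₀`, a start `K₀`, `0 < vol`,
and FILE C's reading of the string's dressed partition functions FROM `K₀` ON — classes `T K`, positive class weights `A K t`, `B K t` with the dictionary
`schemeZ S os (K₀ + K) t = Σ A K t`, `schemeZ S os (K₀ + K + 1) t = Σ B K t` on `|t| ≤ l₀`, (RM)_K with `r K`, (DC)_K with `κ K`, `r K + κ K ≤ vol·δ K`, `Summable δ` ⇒
`∃ δ', Target vol l₀ δ' (schemeZ S os)` (§1–§2 glue the free head). [folklore] -/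
theorem exists_target_schemeZ_of_responseDecorrelationReading (S : Missing.TorusScheme G O) (hβ : ∀ K, 0 ≤ S.β K)
    (hm : ∀ K o, Measurable (S.obs K o)) (h1 : ∀ K o U, |S.obs K o U| ≤ 1) {l₀ vol : ℝ} (hl₀ : 0 ≤ l₀) (hvol : 0 < vol) (os : List O) (K₀ : ℕ)
    (T : ℕ → Finset ι) (A B : ℕ → ℝ → ι → ℝ) (r κ δ : ℕ → ℝ)
    (hT : ∀ K, (T K).Nonempty) (hA : ∀ K t, |t| ≤ l₀ → ∀ τ ∈ T K, 0 < A K t τ) (hB : ∀ K t, |t| ≤ l₀ → ∀ τ ∈ T K, 0 < B K t τ)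
    (hRM : ∀ K t, |t| ≤ l₀ → ∀ τ ∈ T K,
      |(Real.log (B K t τ) - Real.log (B K 0 τ)) - (Real.log (A K t τ) - Real.log (A K 0 τ))| ≤ r K)
    (hDC : ∀ K t, |t| ≤ l₀ →
      |Real.log (∑ τ ∈ T K, B K 0 τ * (A K t τ / A K 0 τ)) - Real.log (∑ τ ∈ T K, B K 0 τ) -
        (Real.log (∑ τ ∈ T K, A K t τ) - Real.log (∑ τ ∈ T K, A K 0 τ))| ≤ κ K)
    (hZA : ∀ K t, |t| ≤ l₀ → T4GenFunBounds.schemeZ S os (K₀ + K) t = ∑ τ ∈ T K, A K t τ)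
    (hZB : ∀ K t, |t| ≤ l₀ → T4GenFunBounds.schemeZ S os (K₀ + K + 1) t = ∑ τ ∈ T K, B K t τ)
    (hbud : ∀ K, r K + κ K ≤ vol * δ K) (hδ : Summable δ) :
    ∃ δ' : ℕ → ℝ, NE7.Target vol l₀ δ' (T4GenFunBounds.schemeZ S os) :=
  exists_target_schemeZ_of_tailTarget S hβ hm h1 hvol os
    (target_of_responseDecorrelationReading (Z := fun K => T4GenFunBounds.schemeZ S os (K₀ + K)) hl₀ T A B r κ hT hA hB hRM hDC hZA
      (fun K t ht => by simpa [Nat.add_assoc] using hZB K t ht) hbud hδ)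

end RoadAtString

/-! ## §5 (v1.1) The road reaches the rung's B5 AS TYPED: per-string targets under the prefix ⇒ `HybridNE7Under` -/

section B5

variable {F : T4Family} {G : Type*} [GaugeGroup G] [MeasurableSpace G] [RegularGaugeGroup G] [HaarData G]

/-- ★★ **THE RESPONSE ROAD REACHES B5 AS TYPED.**  Under the prefix (`(B) → Hβ → ForSmallCouplings D`): if along every tuned bare sequence `g₀` there is a radius `l₀ > 0` at
which EVERY string of `D.scheme g₀` has node U5's target (§3's hypothesis verbatim), and the data's averaging maps are measurable, then `T4ApexHybrid.HybridNE7Under D Hβ`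
— the rung `BalabanLadder.UV`'s binder B5 and K3⁸'s conclusion shape.  One line over dag-n23-b's `T4MatchingDegenerate.hybridNE7Under_of_matchingUnder` (degenerate
one-class expansion): the hybrid datum is existential over its class index, so it carries NO `Hom` ∕ class-uniform-constant content beyond `Target`.  ERRATUM to v1.0's
located remark (module docstring, v1.1 paragraph). [folklore] -/
theorem hybridNE7Under_of_targetsUnder (D : FiniteEpsData F G) (hM : D.AvgMeasurable) {Hβ : Prop}
    (h : D.UnderHypotheses Hβ fun g₀ => ∃ l₀ : ℝ, 0 < l₀ ∧
      ∀ os : List (T4Continuum.ULoop F), ∃ (vol : ℝ) (δ : ℕ → ℝ), NE7.Target vol l₀ δ (T4GenFunBounds.schemeZ (D.scheme g₀) os)) :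
    T4ApexHybrid.HybridNE7Under D Hβ :=
  T4MatchingDegenerate.hybridNE7Under_of_matchingUnder D hM
    (T4Continuum.FiniteEpsData.UnderHypotheses.mono (fun g₀ hg os => by
      obtain ⟨l₀, hl₀, hos⟩ := hg
      obtain ⟨vol, δ, hT⟩ := hos os
      exact ⟨l₀, vol, δ, hl₀, hT.2, hT.1⟩) h)

/-- **B5 ⟺ PER-STRING TARGETS UNDER THE PREFIX** (each string its own radius `l₀(os) > 0` and volume factor): `T4MatchingDegenerate.hybridNE7Under_iff_matchingUnder` with
`T4ApexVariance.StringwiseMatching` read in `Spine.NE7.Target` letters (`Target vol l₀ δ Z = MatchingModConstants ∧ Summable δ`).  For data with measurable averaging maps,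
any β-side hypothesis `Hβ`. [folklore] -/
theorem hybridNE7Under_iff_stringTargetsUnder (D : FiniteEpsData F G) (hM : D.AvgMeasurable) (Hβ : Prop) :
    T4ApexHybrid.HybridNE7Under D Hβ ↔ D.UnderHypotheses Hβ fun g₀ =>
      ∀ os : List (T4Continuum.ULoop F), ∃ (l₀ vol : ℝ) (δ : ℕ → ℝ), 0 < l₀ ∧ NE7.Target vol l₀ δ (T4GenFunBounds.schemeZ (D.scheme g₀) os) := by
  rw [T4MatchingDegenerate.hybridNE7Under_iff_matchingUnder D hM Hβ]
  constructor
  · exact T4Continuum.FiniteEpsData.UnderHypotheses.mono fun g₀ hg os => by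
      obtain ⟨l₀, vol, δ, hl₀, hδ, hMM⟩ := hg os
      exact ⟨l₀, vol, δ, hl₀, hMM, hδ⟩
  · exact T4Continuum.FiniteEpsData.UnderHypotheses.mono fun g₀ hg os => by
      obtain ⟨l₀, vol, δ, hl₀, hT⟩ := hg os
      exact ⟨l₀, vol, δ, hl₀, hT.2, hT.1⟩

/-- ★ **THE ROAD's END AT B5**: §4's per-string response ∕ decorrelation readings supply §3's hypothesis string by string; packaged under the prefix they give B5.  Stated
as the composition `hybridNE7Under_of_targetsUnder` expects — the per-`g₀` radius `l₀` and per-string targets are the DISPLAYED hypothesis (produced by nobody). [folklore] -/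
theorem hybridNE7Under_of_stringwiseUnder_targets (D : FiniteEpsData F G) (hM : D.AvgMeasurable) {Hβ : Prop}
    (h : D.UnderHypotheses Hβ fun g₀ =>
      ∀ os : List (T4Continuum.ULoop F), ∃ (l₀ vol : ℝ) (δ : ℕ → ℝ), 0 < l₀ ∧ NE7.Target vol l₀ δ (T4GenFunBounds.schemeZ (D.scheme g₀) os)) :
    T4ApexHybrid.HybridNE7Under D Hβ :=
  (hybridNE7Under_iff_stringTargetsUnder D hM Hβ).2 h

end B5

end Summit.QuantumFields.YangMills.BalabanUVNodes.N19ResponseRoadAtScheme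

end
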